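import Literature.NumberTheory.IwasawaTheory.WeakLeopoldtCyclotomicLevels
import Literature.NumberTheory.GaloisCohomology.CyclotomicKillingPrimePower
import Literature.NumberTheory.IwasawaTheory.PruferPontryaginDual
import HarnessLib

/-!
# Crux `GoodLatticeBDPValue` (stmt-BirchSwinnertonDyer-19032), line `halves`, stub 4, (T4) ⟸ cycWL: PREPARATIONS
# for the adapter «(A) + (B) ⟹ stagesDie» — levels acting trivially on `μ_{p^a}`, a deeper stage inside a
# layer of `κ^{cyc}` (compactness), a Prüfer embedding `ℚ_p/ℤ_p ↪ K̄ˣ` reaching all `p`-power roots of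
# unity, and abstract cochain plumbing for trivial coefficients

Width seat `bsd-line-x1-p1-w4` (gen 15), cell `bsd-eis`; `--supports stmt-BirchSwinnertonDyer-19032`.
Theorems only (no definition, no named fact, no instance, no `sorry`).  Consumed by the sibling
`EisensteinPrimesGoodLatticeBDPValueStagesDie.lean` (the adapter itself); see its module docstring for the
road (w2 g7's `WeakLeopoldtCyclotomicLevels` / `…Assembly`, w6 g7's `RestrictedRamificationInflationKernel`,
w3 g12's `RestrictedRamificationKummer`, the tree's `CyclotomicKillingPrimePower`).

* §1 `mu_apply_eq_self_of_mem_ker` (`F_j = ker χ̄_{p^j}` acts trivially on `μ_{p^a}`, `a ≤ j`),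
  `smul_rootsOfUnity_eq_self_of_mem_ker`, `exists_inf_ker_le_layerSubgroup` (for every `M`, `k` some
  `k₂ ≥ k` with `U₀ ∩ F_{k₂} ≤ κ^{cyc}⁻¹(p^M ℤ_p)`: the closed `U₀ ∩ F_j` decrease to
  `U₀ ∩ ker χ_p ⊆ ker κ^{cyc}`, w2 g7's `iInf_ker_modNCyclotomicCharacter_le_kerSubgroup`, inside the OPEN
  layer subgroup; compactness of `Γ_K`);
* §2 `exists_eq_apply_of_pow_eq_one` (an injective `j : ℚ_p/ℤ_p → Lˣ` hits every `p^n`-th root of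
  unity: counting against `QpModZp.units_torsionBound`);
* §3 `exists_twoCocycle_trivial_map` / `_comap` / `exists_twoCocycle_inflate_of_trivial_action`
  (push-forward along an additive map of coefficients, pull-back along a continuous homomorphism, and
  inflation into a representation acting trivially on the values, for continuous `2`-cocycles with
  trivial coefficients — stated over abstract groups so that the instances elaborate cheaply).

HONEST FRAMING: bookkeeping; nothing arithmetic is proved here; no case of the crux or of BSD.

References: [Washington1997] §13.1; [SerreGaloisCohomology1997] I §2.2, §2.4, II §4.4;
[Greenberg2006] p. 338; [Hungerford1974] Ch. I §3.
-/

-- D-0017: single-problem summit, the namespace repeats the problem name by design.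
set_option linter.dupNamespace false
set_option autoImplicit false

noncomputable section

open scoped Classical
open NumberField IsDedekindDomain Field Function Topology
open Literature.NumberTheory.GaloisRepresentations
open Literature.NumberTheory.GaloisRepresentations.DiscreteGaloisModule
open Literature.NumberTheory.GaloisRepresentations.LocalWeilDatum
open Literature.NumberTheory.EllipticCurves (ZpExtension)
open Literature.NumberTheory.IwasawaTheory Literature.NumberTheory.IwasawaTheory.Greenberg2006
open Literature.NumberTheory.GaloisCohomology
open _root_.TopRep _root_.ContRepresentation _root_.ContinuousCohomology

namespace Summit.BirchSwinnertonDyer.BirchSwinnertonDyer.Theorems.GoodLatticeBDPValueCycWLStagePrep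

/-! ### §1. The stages `U₀ ∩ F_j` act trivially on `μ_{p^a}` (`a ≤ j`); a deeper stage inside a layer -/

section Levels

variable {K : Type} [Field K] [NumberField K] {p : ℕ} [hp : Fact p.Prime]

/-- **`F_j = Gal(K̄/K(μ_{p^j}))` acts trivially on the Galois module `μ_{p^a}` for `a ≤ j`.**
[cite: Washington1997, §13.1] -/
theorem mu_apply_eq_self_of_mem_ker {a j : ℕ} (haj : a ≤ j) {σ : absoluteGaloisGroup K}
    (hσ : σ ∈ (modNCyclotomicCharacter K (p ^ j)).ker) (v : MuCarrier K (p ^ a)) :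
    mu K (p ^ a) σ v = v := by
  have hσa : σ ∈ (modNCyclotomicCharacter K (p ^ a)).ker := ker_modNCyclotomicCharacter_antitone p haj hσ
  apply muVal_injective K (p ^ a)
  rw [muVal_apply]
  refine Units.ext ?_
  rw [Units.coe_smul]
  refine smul_eq_self_of_mem_ker_modNCyclotomicCharacter p hσa ?_
  have h := muVal_pow_eq_one K (p ^ a) v
  have h' := congrArg (fun u : (AlgebraicClosure K)ˣ => (u : AlgebraicClosure K)) h
  simpa only [Units.val_pow_eq_pow_val, Units.val_one] using h'

/-- `F_j` fixes the `p`-th roots of unity as units, for `1 ≤ j` (hypothesis shape of the tree's killing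
lemma). [cite: SerreGaloisCohomology1997, II §4.4] -/
theorem smul_rootsOfUnity_eq_self_of_mem_ker {j : ℕ} (hj : 1 ≤ j) {σ : absoluteGaloisGroup K}
    (hσ : σ ∈ (modNCyclotomicCharacter K (p ^ j)).ker) (ζ : rootsOfUnity p (AlgebraicClosure K)) :
    σ • (ζ : (AlgebraicClosure K)ˣ) = ζ := by
  have hσ1 : σ ∈ (modNCyclotomicCharacter K (p ^ 1)).ker := ker_modNCyclotomicCharacter_antitone p hj hσ
  have hζ : ((ζ : (AlgebraicClosure K)ˣ) : AlgebraicClosure K) ^ p ^ 1 = 1 := by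
    have h := ζ.2
    rw [mem_rootsOfUnity] at h
    have h' := congrArg (fun u : (AlgebraicClosure K)ˣ => (u : AlgebraicClosure K)) h
    simpa only [Units.val_pow_eq_pow_val, Units.val_one, pow_one] using h'
  exact Units.ext (by rw [Units.coe_smul]; exact smul_eq_self_of_mem_ker_modNCyclotomicCharacter p hσ1 hζ)

/-- **A deeper stage inside a layer**: for every `M` and `k` there is `k₂ ≥ k` with
`U₀ ∩ F_{k₂} ≤ κ^{cyc}⁻¹(p^M ℤ_p)` — compactness of `Γ_K`: the closed sets `U₀ ∩ F_j` decrease to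
`U₀ ∩ ker χ_p ⊆ ker κ^{cyc} ⊆ κ^{cyc}⁻¹(p^M ℤ_p)`, an OPEN set. [cite: Washington1997, §13.1] -/
theorem exists_inf_ker_le_layerSubgroup {κ : ZpExtension K p} (hκ : κ.IsCyclotomic)
    (U₀ : Subgroup (absoluteGaloisGroup K)) (hU₀ : IsOpen (U₀ : Set (absoluteGaloisGroup K)))
    (M k : ℕ) :
    ∃ k₂ : ℕ, k ≤ k₂ ∧ U₀ ⊓ (modNCyclotomicCharacter K (p ^ k₂)).ker ≤ κ.layerSubgroup M := by
  haveI : CompactSpace (absoluteGaloisGroup K) := absoluteGaloisGroup_compactSpace K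
  set C : ℕ → Set (absoluteGaloisGroup K) :=
    fun j ↦ ((U₀ ⊓ (modNCyclotomicCharacter K (p ^ j)).ker : Subgroup (absoluteGaloisGroup K)) :
      Set (absoluteGaloisGroup K)) with hC
  have hCcl : ∀ j, IsClosed (C j) := fun j ↦
    (Subgroup.isClosed_of_isOpen U₀ hU₀).inter
      (Subgroup.isClosed_of_isOpen _ (isOpen_ker_modNCyclotomicCharacter p j))
  set O : Set (absoluteGaloisGroup K) := (κ.layerSubgroup M : Set (absoluteGaloisGroup K)) with hO
  have hOo : IsOpen O := κ.isOpen_layerSubgroup M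
  -- `⋂ C_j ⊆ O`
  have hsub : (⋂ j, C j) ⊆ O := by
    intro σ hσ
    rw [Set.mem_iInter] at hσ
    have h1 : σ ∈ (⨅ j : ℕ, (modNCyclotomicCharacter K (p ^ j)).ker) :=
      Subgroup.mem_iInf.mpr fun j ↦ (Subgroup.mem_inf.mp (hσ j)).2
    exact κ.kerSubgroup_le_layerSubgroup M (iInf_ker_modNCyclotomicCharacter_le_kerSubgroup p hκ h1)
  -- compactness: some `C_j ⊆ O`
  have hcpt : IsCompact Oᶜ := hOo.isClosed_compl.isCompact
  have hempty : Oᶜ ∩ ⋂ j, C j = ∅ := by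
    rw [Set.eq_empty_iff_forall_notMem]
    rintro x ⟨hx1, hx2⟩
    exact hx1 (hsub hx2)
  have hanti : ∀ j j', j ≤ j' → C j' ⊆ C j := fun j j' hjj' x hx ↦
    ⟨hx.1, ker_modNCyclotomicCharacter_antitone p hjj' hx.2⟩
  have hdir : Directed (· ⊇ ·) C := fun i j ↦
    ⟨max i j, hanti _ _ (le_max_left i j), hanti _ _ (le_max_right i j)⟩
  obtain ⟨j, hj⟩ := hcpt.elim_directed_family_closed _ hCcl hempty hdir
  refine ⟨max k j, le_max_left k j, fun σ hσ ↦ ?_⟩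
  have hσj : σ ∈ C j := hanti _ _ (le_max_right k j) hσ
  by_contra hσO
  exact (Set.eq_empty_iff_forall_notMem.1 hj) σ ⟨hσO, hσj⟩

end Levels

/-! ### §2. A Prüfer embedding `ℚ_p/ℤ_p ↪ K̄ˣ` reaches every `p`-power root of unity -/

section Prufer

variable {p : ℕ} [hp : Fact p.Prime] {L : Type*} [Field L]

omit hp in
/-- A Prüfer embedding sends `p^n`-torsion to `p^n`-th roots of unity. [cite: Greenberg2006, p. 338 lines 15–16] -/
theorem toMul_pow_eq_one_of_nsmul_eq_zero {D : Type*} [AddCommGroup D] (j : D →+ Additive Lˣ)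
    {n : ℕ} {x : D} (hx : p ^ n • x = 0) : (Additive.toMul (j x)) ^ (p ^ n) = 1 := by
  rw [← toMul_nsmul, ← map_nsmul, hx, map_zero, toMul_zero]

/-- **Every `p^n`-th root of unity of `L` is `j(x)` with `p^n x = 0`, for an injective
`j : ℚ_p/ℤ_p ↪ Lˣ`** (the `p^n` distinct units `j(k t_n)` are `p^n`-torsion, and a field has at most `p^n`
such — tree `QpModZp.units_torsionBound`). [cite: Greenberg2006, p. 338 lines 15–16] -/
theorem exists_eq_apply_of_pow_eq_one {j : QpModZp p →+ Additive Lˣ} (hj : Function.Injective j)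
    {n : ℕ} {u : Lˣ} (hu : u ^ (p ^ n) = 1) :
    ∃ x : QpModZp p, p ^ n • x = 0 ∧ j x = Additive.ofMul u := by
  classical
  let f : ℕ → Additive Lˣ := fun k ↦ j ((k : ℤ_[p]) • QpModZp.tgen p n)
  let s : Finset (Additive Lˣ) := (Finset.range (p ^ n)).image f
  have hinj : Set.InjOn f (Finset.range (p ^ n) : Set ℕ) := by
    intro k hk k' hk' hkk'
    have h1 := QpModZp.natCast_eq_natCast_of_smul_tgen_eq (hj hkk')
    rw [ZMod.natCast_eq_natCast_iff', Nat.mod_eq_of_lt (Finset.mem_range.mp hk),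
      Nat.mod_eq_of_lt (Finset.mem_range.mp hk')] at h1
    exact h1
  have hcard : s.card = p ^ n := by
    rw [Finset.card_image_of_injOn hinj, Finset.card_range]
  have hc : p ^ n • Additive.ofMul u = 0 := by
    rw [← ofMul_pow, hu, ofMul_one]
  have htors : ∀ c' ∈ insert (Additive.ofMul u) s, p ^ n • c' = 0 := by
    intro c' hc'
    rcases Finset.mem_insert.mp hc' with rfl | hc'
    · exact hc
    · obtain ⟨k, -, rfl⟩ := Finset.mem_image.mp hc'
      change p ^ n • j ((k : ℤ_[p]) • QpModZp.tgen p n) = 0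
      rw [← map_nsmul, smul_comm, QpModZp.pow_nsmul_tgen, smul_zero, map_zero]
  by_cases hmem : Additive.ofMul u ∈ s
  · obtain ⟨k, -, hk⟩ := Finset.mem_image.mp hmem
    refine ⟨(k : ℤ_[p]) • QpModZp.tgen p n, ?_, hk⟩
    rw [smul_comm, QpModZp.pow_nsmul_tgen, smul_zero]
  · exfalso
    have := QpModZp.units_torsionBound (p := p) n _ htors
    rw [Finset.card_insert_of_notMem hmem, hcard] at this
    omega

end Prufer

/-! ### §2b. Cochain plumbing for trivial coefficients (abstract groups; cheap to elaborate) -/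

section Plumbing

variable {G : Type} [Group G] [TopologicalSpace G]
variable {G' : Type} [Group G'] [TopologicalSpace G']
variable {A : Type} [AddCommGroup A] [TopologicalSpace A] [DiscreteTopology A]
variable {B : Type} [AddCommGroup B] [TopologicalSpace B] [DiscreteTopology B]

/-- **Push-forward of a trivial-coefficient continuous `2`-cocycle along an additive map of
coefficients** (`c ↦ θ ∘ c`). [cite: SerreGaloisCohomology1997, I §2.2] -/
theorem exists_twoCocycle_trivial_map (θ : A → B) (hθ : ∀ x y, θ (x + y) = θ x + θ y)
    (c : contTwoCocycles (ContinuousRep.trivial G ℤ A).toTopRep) :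
    ∃ c' : contTwoCocycles (ContinuousRep.trivial G ℤ B).toTopRep, ∀ x y, c'.1 (x, y) = θ (c.1 (x, y)) := by
  have hθc : Continuous θ := continuous_of_discreteTopology
  let F : C(G × G, B) := ⟨fun q ↦ θ (c.1 q), hθc.comp c.1.continuous⟩
  refine ⟨⟨F, fun x y z ↦ ?_⟩, fun x y ↦ rfl⟩
  have h := c.2 x y z
  rw [ContinuousRep.toTopRep_ρ_apply, ContinuousRep.trivial_apply] at h
  rw [ContinuousRep.toTopRep_ρ_apply, ContinuousRep.trivial_apply]
  change θ (c.1 (y, z)) + θ (c.1 (x, y * z)) = θ (c.1 (x * y, z)) + θ (c.1 (x, y))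
  rw [← hθ, ← hθ, h]

/-- **Pull-back of a trivial-coefficient continuous `2`-cocycle along a continuous homomorphism**
(`c ↦ c ∘ (φ × φ)`). [cite: SerreGaloisCohomology1997, I §2.4] -/
theorem exists_twoCocycle_trivial_comap (φ : G' →* G) (hφ : Continuous φ)
    (c : contTwoCocycles (ContinuousRep.trivial G ℤ A).toTopRep) :
    ∃ c' : contTwoCocycles (ContinuousRep.trivial G' ℤ A).toTopRep,
      ∀ x y, c'.1 (x, y) = c.1 (φ x, φ y) := by
  let F : C(G' × G', A) := ⟨fun q ↦ c.1 (φ q.1, φ q.2), c.1.continuous.comp (hφ.prodMap hφ)⟩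
  refine ⟨⟨F, fun x y z ↦ ?_⟩, fun x y ↦ rfl⟩
  have h := c.2 (φ x) (φ y) (φ z)
  rw [ContinuousRep.toTopRep_ρ_apply, ContinuousRep.trivial_apply] at h
  rw [ContinuousRep.toTopRep_ρ_apply, ContinuousRep.trivial_apply]
  change c.1 (φ y, φ z) + c.1 (φ x, φ (y * z)) = c.1 (φ (x * y), φ z) + c.1 (φ x, φ y)
  rw [map_mul, map_mul, h]

/-- **Inflation of a trivial-coefficient `2`-cocycle along a continuous homomorphism into a
representation acting trivially on the values** (`c ↦ c ∘ (q × q)` as a cocycle of `ρ`, when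
`ρ(t) = id` for all `t`). [cite: SerreGaloisCohomology1997, I §2.4] -/
theorem exists_twoCocycle_inflate_of_trivial_action (q : G' →* G) (hq : Continuous q)
    (ρ : ContinuousRep G' ℤ A) (hρ : ∀ (t : G') (x : A), ρ t x = x)
    (c : contTwoCocycles (ContinuousRep.trivial G ℤ A).toTopRep) :
    ∃ c' : contTwoCocycles ρ.toTopRep, ∀ x y, c'.1 (x, y) = c.1 (q x, q y) := by
  let F : C(G' × G', A) := ⟨fun z ↦ c.1 (q z.1, q z.2), c.1.continuous.comp (hq.prodMap hq)⟩
  refine ⟨⟨F, fun x y z ↦ ?_⟩, fun x y ↦ rfl⟩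
  have h := c.2 (q x) (q y) (q z)
  rw [ContinuousRep.toTopRep_ρ_apply, ContinuousRep.trivial_apply] at h
  rw [ContinuousRep.toTopRep_ρ_apply, hρ]
  change c.1 (q y, q z) + c.1 (q x, q (y * z)) = c.1 (q (x * y), q z) + c.1 (q x, q y)
  rw [map_mul, map_mul, h]

end Plumbing

end Summit.BirchSwinnertonDyer.BirchSwinnertonDyer.Theorems.GoodLatticeBDPValueCycWLStagePrep

end
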